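import Summits.CriticalPhenomena.PercolationContinuityZ3.Theorems.PercNearOneGluingNoHeavyLowerTailIncStarRootPairChord
import Summits.CriticalPhenomena.PercolationContinuityZ3.Theorems.PercNearOneGluingNoHeavyLowerTailIncStarPsiTree
import HarnessLib

/-!
# THEOREM B′-forest: root-pair concavity at a separating vertex of an apex-forest

Support file for the Sahi programme (`--supports stmt-CriticalPhenomena-4575`, prover prim-sahi-p2 gen 19).  No definitions, no named
facts, no sorries; standard axioms.  Memo `prim-sahi-p2/PROOF-E3.md` (28s)–(28u), (29d), (29n); lead g120's CONJECTURE FC, cases (a) (root pair at an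
unmarked vertex separating the targets 1|2) and (b) (root pair at a target).

**Theorem `rootPair_threePoint_of_apexForest` (concavity) and `rootPair_chord_of_apexForest` (chord).**  Let the non-root pairs of positive
weight form a forest, let `x ≠ s`, and let `L ∌ s, x` be a set of vertices with no positive pair to `{y | y ∉ L, y ≠ s, y ≠ x}` (e.g. a union of
branches of the forest at `x`), with targets `a ∈ insert x L` and `b, c ∉ L ∪ {s}`.  Then along the root pair `e = s(s, x)` the cubic
`q ↦ E₃(w[e↦q])`, `E₃ = E₃({s↔a},{s↔b},{s↔c})`, is CONCAVE on `[0,1]`: for `0 ≤ p₀ ≤ p ≤ p₁ ≤ 1`,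
`(p₁ − p)·E₃(w[e↦p₀]) + (p − p₀)·E₃(w[e↦p₁]) ≤ (p₁ − p₀)·E₃(w[e↦p])`; in particular `(1 − w e)·E₃(w[e↦0]) + (w e)·E₃(w[e↦1]) ≤ E₃(w)`.
Proof: `IncStar.rootPair_threePoint` (part III) with its two block inputs discharged by THEOREM (I2′)-tree `IncStar.psi_nonneg` and the branch lemma
`IncStar.branchLemma` applied to the weights RESTRICTED to the far / near block (`IncStar.real_restrict_eq_of_determinedBy`; under the restricted
weights the global connection events are the block events almost surely).  The three-point (sub-interval) form is what the reductions of FC's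
remaining root-pair cases need (`…IncStarRootPairConcaveForest`, PROOF-E3 §30).
-/

noncomputable section

namespace Summit.CriticalPhenomena.PercolationContinuityZ3.Theorems

namespace IncStar

open MeasureTheory Set Literature.Probability.Percolation Literature.Probability.LatticeModels EdgeInduction
open scoped Classical

variable {n : ℕ}

/-- Almost-sure congruence (plumbing). [folklore] -/
private theorem rpf_congr {μ : Measure (BondConfig (Fin n))} [IsProbabilityMeasure μ] {G A A' : Set (BondConfig (Fin n))}
    (hG : μ.real G = 1) (h : ∀ ω ∈ G, (ω ∈ A ↔ ω ∈ A')) : μ.real A = μ.real A' := by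
  rw [real_eq_real_inter_of_real_eq_one MeasurableSet.of_discrete hG A,
    real_eq_real_inter_of_real_eq_one MeasurableSet.of_discrete hG A']
  congr 1
  ext ω
  simp only [Set.mem_inter_iff]
  constructor
  · rintro ⟨h1, h2⟩; exact ⟨(h ω h2).1 h1, h2⟩
  · rintro ⟨h1, h2⟩; exact ⟨(h ω h2).2 h1, h2⟩

/-- **THEOREM B′-forest, concavity form (root pair at a separating vertex, or at a target): three-point inequality on `[0,1]`.**
[this work] -/
theorem rootPair_threePoint_of_apexForest (w : Sym2 (Fin n) → unitInterval) (L : Set (Fin n)) {s x a b c : Fin n}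
    (hxs : x ≠ s) (hsL : s ∉ L) (hxL : x ∉ L) (haL : a ∈ (insert x L : Set (Fin n)))
    (hbL : b ∉ L) (hbs : b ≠ s) (hcL : c ∉ L) (hcs : c ≠ s)
    (hcross : ∀ y z : Fin n, y ∈ L → z ∉ L → z ≠ s → z ≠ x → w s(y, z) = 0)
    (hforest : (SimpleGraph.fromEdgeSet {z : Sym2 (Fin n) | s ∉ z ∧ w z ≠ 0}).IsAcyclic)
    (p₀ p p₁ : unitInterval) (h01 : p₀ ≤ p) (h12 : p ≤ p₁) :
    ((p₁ : ℝ) - (p : ℝ)) * sahiE3 (prodBernoulli (Function.update w s(s, x) p₀)) (openConn s a) (openConn s b) (openConn s c)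
      + ((p : ℝ) - (p₀ : ℝ)) * sahiE3 (prodBernoulli (Function.update w s(s, x) p₁)) (openConn s a) (openConn s b) (openConn s c)
    ≤ ((p₁ : ℝ) - (p₀ : ℝ)) * sahiE3 (prodBernoulli (Function.update w s(s, x) p)) (openConn s a) (openConn s b) (openConn s c) := by
  -- names (as in part III)
  set e : Sym2 (Fin n) := s(s, x) with he_def
  set w0 := Function.update w e 0 with hw0
  set V₁ : Set (Fin n) := insert x L with hV₁_def
  set V₂ : Set (Fin n) := {y | y ∉ L ∧ y ≠ s} with hV₂_def
  set R₀ : Set (Fin n) := {u : Fin n | u ∉ L ∧ u ≠ s ∧ u ≠ x} with hR₀_def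
  set AL : Set (BondConfig (Fin n)) := {ω | ∃ u ∈ L, s(s, u) ∈ ω ∧ ω ∈ openConnIn V₁ u a} with hAL_def
  set SL : Set (BondConfig (Fin n)) := {ω | ∃ u ∈ L, s(s, u) ∈ ω ∧ ω ∈ openConnIn V₁ u x} with hSL_def
  set Fa : Set (BondConfig (Fin n)) := openConnIn V₁ x a with hFa_def
  set BRb : Set (BondConfig (Fin n)) := {ω | ∃ u ∈ R₀, s(s, u) ∈ ω ∧ ω ∈ openConnIn V₂ u b} with hBRb_def
  set BRc : Set (BondConfig (Fin n)) := {ω | ∃ u ∈ R₀, s(s, u) ∈ ω ∧ ω ∈ openConnIn V₂ u c} with hBRc_def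
  set SR : Set (BondConfig (Fin n)) := {ω | ∃ u ∈ R₀, s(s, u) ∈ ω ∧ ω ∈ openConnIn V₂ u x} with hSR_def
  set Fb : Set (BondConfig (Fin n)) := openConnIn V₂ x b with hFb_def
  set Fc : Set (BondConfig (Fin n)) := openConnIn V₂ x c with hFc_def
  set KL : Set (Sym2 (Fin n)) := {z : Sym2 (Fin n) | ¬ z.IsDiag ∧ ∀ v ∈ z, v ∈ V₁} ∪ {z | ∃ u ∈ L, z = s(s, u)}
  set KR : Set (Sym2 (Fin n)) := {z : Sym2 (Fin n) | ¬ z.IsDiag ∧ ∀ v ∈ z, v ∈ V₂} ∪ {z | ∃ u ∈ R₀, z = s(s, u)}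
  have hm : ∀ X : Set (BondConfig (Fin n)), MeasurableSet X := fun _ => MeasurableSet.of_discrete
  have hx1 : x ∈ V₁ := Set.mem_insert x L
  have hx2 : x ∈ V₂ := ⟨hxL, hxs⟩
  have hb2 : b ∈ V₂ := ⟨hbL, hbs⟩
  have hc2 : c ∈ V₂ := ⟨hcL, hcs⟩
  have hV := rootPair_cut_hV L (s := s) (x := x)
  -- structural facts
  have fL1 : ∀ {t : Fin n} (ω : BondConfig (Fin n)), ω ∈ {ω | ∃ u ∈ L, s(s, u) ∈ ω ∧ ω ∈ openConnIn V₁ u t} →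
      ω ∈ openConnIn V₁ x t → ω ∈ SL := fun ω h hF => rootStar_port_of_rootStar_of_openConnIn L V₁ ω h hF
  have fR1 : ∀ {t : Fin n} (ω : BondConfig (Fin n)), ω ∈ {ω | ∃ u ∈ R₀, s(s, u) ∈ ω ∧ ω ∈ openConnIn V₂ u t} →
      ω ∈ openConnIn V₂ x t → ω ∈ SR := fun ω h hF => rootStar_port_of_rootStar_of_openConnIn R₀ V₂ ω h hF
  -- determined-by facts
  have hdiff : ∀ {A B : Set (BondConfig (Fin n))} {K' : Set (Sym2 (Fin n))},
      DeterminedBy A K' → DeterminedBy B K' → DeterminedBy (A \ B) K' := by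
    intro A B K' hA hB
    rw [determinedBy_iff] at hA hB ⊢
    intro ω ω' h
    rw [Set.mem_sdiff, Set.mem_sdiff, hA ω ω' h, hB ω ω' h]
  have hunion : ∀ {A B : Set (BondConfig (Fin n))} {K' : Set (Sym2 (Fin n))},
      DeterminedBy A K' → DeterminedBy B K' → DeterminedBy (A ∪ B) K' := by
    intro A B K' hA hB
    rw [determinedBy_iff] at hA hB ⊢
    intro ω ω' h
    rw [Set.mem_union, Set.mem_union, hA ω ω' h, hB ω ω' h]
  have dAL : DeterminedBy AL KL := determinedBy_rootStar L V₁ s a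
  have dSL : DeterminedBy SL KL := determinedBy_rootStar L V₁ s x
  have dFa : DeterminedBy Fa KL := (IncStarCutVertex.determinedBy_openConnIn_offDiag V₁ x a).mono Set.subset_union_left
  have dBRb : DeterminedBy BRb KR := determinedBy_rootStar R₀ V₂ s b
  have dBRc : DeterminedBy BRc KR := determinedBy_rootStar R₀ V₂ s c
  have dSR : DeterminedBy SR KR := determinedBy_rootStar R₀ V₂ s x
  have dFb : DeterminedBy Fb KR := (IncStarCutVertex.determinedBy_openConnIn_offDiag V₂ x b).mono Set.subset_union_left
  have dFc : DeterminedBy Fc KR := (IncStarCutVertex.determinedBy_openConnIn_offDiag V₂ x c).mono Set.subset_union_left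
  -- which pairs are NOT in the blocks
  have e_notR : e ∉ KR := by
    rintro (⟨-, h⟩ | ⟨u, hu, h⟩)
    · exact (h s (by rw [he_def]; exact Sym2.mem_mk_left s x)).2 rfl
    · rw [he_def, Sym2.eq_iff] at h
      rcases h with ⟨-, h⟩ | ⟨h, -⟩
      · exact hu.2.2 h.symm
      · exact hu.2.1 h.symm
  have e_notL : e ∉ KL := by
    rintro (⟨-, h⟩ | ⟨u, hu, h⟩)
    · rcases Set.mem_insert_iff.1 (h s (by rw [he_def]; exact Sym2.mem_mk_left s x)) with h' | h'
      · exact hxs h'.symm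
      · exact hsL h'
    · rw [he_def, Sym2.eq_iff] at h
      rcases h with ⟨-, h⟩ | ⟨h, -⟩
      · exact hxL (h ▸ hu)
      · exact hsL (h ▸ hu)
  have Lpair_notR : ∀ y z : Fin n, y ∈ L → s(y, z) ∉ KR := by
    rintro y z hy (⟨-, h⟩ | ⟨u, hu, h⟩)
    · exact (h y (Sym2.mem_mk_left y z)).1 hy
    · rw [Sym2.eq_iff] at h
      rcases h with ⟨h, -⟩ | ⟨h, -⟩
      · exact hsL (h ▸ hy)
      · exact hu.1 (h ▸ hy)
  have cross_notL : ∀ y z : Fin n, y ∈ L → z ∉ L → z ≠ s → z ≠ x → s(y, z) ∉ KL := by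
    rintro y z hy hz hzs hzx (⟨-, h⟩ | ⟨u, hu, h⟩)
    · rcases Set.mem_insert_iff.1 (h z (Sym2.mem_mk_right y z)) with h' | h'
      · exact hzx h'
      · exact hz h'
    · rw [Sym2.eq_iff] at h
      rcases h with ⟨h, -⟩ | ⟨-, h⟩
      · exact hsL (h ▸ hy)
      · exact hzs h
  have Rroot_notL : ∀ u : Fin n, u ∈ R₀ → s(s, u) ∉ KL := by
    rintro u hu (⟨-, h⟩ | ⟨u', hu', h⟩)
    · rcases Set.mem_insert_iff.1 (h s (Sym2.mem_mk_left s u)) with h' | h'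
      · exact hxs h'.symm
      · exact hsL h'
    · rw [Sym2.eq_iff] at h
      rcases h with ⟨-, rfl⟩ | ⟨-, h2⟩
      · exact hu.1 hu'
      · exact hu.2.1 h2
  -- ================= the far block: restricted weight `wR` =================
  obtain ⟨wR, hwR⟩ : ∃ f : Sym2 (Fin n) → unitInterval,
      f = fun z => @ite _ (z ∈ KR) (Classical.propDecidable (z ∈ KR)) (w0 z) 0 := ⟨_, rfl⟩
  have hwR0 : ∀ z, z ∉ KR → wR z = 0 := fun z hz => by simp only [hwR, if_neg hz]
  have w0_ne : ∀ z : Sym2 (Fin n), w0 z ≠ 0 → w z ≠ 0 := by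
    intro z hz
    by_cases hze : z = e
    · rw [hze, hw0, Function.update_self] at hz; exact absurd rfl hz
    · rwa [hw0, Function.update_of_ne hze] at hz
  have hforestR : (SimpleGraph.fromEdgeSet {z : Sym2 (Fin n) | s ∉ z ∧ wR z ≠ 0}).IsAcyclic := by
    refine hforest.anti fun p q hpq => ?_
    rw [SimpleGraph.fromEdgeSet_adj] at hpq ⊢
    obtain ⟨⟨hs', hw'⟩, hne⟩ := hpq
    refine ⟨⟨hs', w0_ne _ fun h0 => hw' ?_⟩, hne⟩
    by_cases hz : s(p, q) ∈ KR
    · simp only [hwR, if_pos hz, h0]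
    · simp only [hwR, if_neg hz]
  set SgR : Set (BondConfig (Fin n)) := {ω | ∀ z, wR z = 0 → z ∉ ω}
  have hSgR1 : (prodBernoulli wR).real SgR = 1 := real_sureClosed wR
  have hRω : ∀ ω ∈ SgR, ∀ y z : Fin n, y ∈ L → z ∉ L → z ≠ s → z ≠ x → s(y, z) ∉ ω :=
    fun ω hω y z hy _ _ _ => hω _ (hwR0 _ (Lpair_notR y z hy))
  have hRe : ∀ ω ∈ SgR, e ∉ ω := fun ω hω => hω _ (hwR0 _ e_notR)
  have hRSL : ∀ ω ∈ SgR, ∀ t : Fin n, ω ∉ {ω : BondConfig (Fin n) | ∃ u ∈ L, s(s, u) ∈ ω ∧ ω ∈ openConnIn V₁ u t} := by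
    rintro ω hω t ⟨u, hu, hsu, -⟩
    have hnot : s(s, u) ∉ KR := by rw [Sym2.eq_swap]; exact Lpair_notR u s hu
    exact hω _ (hwR0 _ hnot) hsu
  -- dictionary under `wR`
  have rS : ∀ ω ∈ SgR, ∀ {t : Fin n}, t ∉ L → t ≠ s →
      (ω ∈ openConn s t ↔ ω ∈ {ω : BondConfig (Fin n) | ∃ u ∈ R₀, s(s, u) ∈ ω ∧ ω ∈ openConnIn V₂ u t}) := by
    intro ω hω t htL hts
    rw [rootPair_conn_right L hxs hsL hxL (hRω ω hω) (hRe ω hω) htL hts]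
    constructor
    · rintro (h | ⟨hS, -⟩)
      · exact h
      · exact absurd hS (hRSL ω hω x)
    · exact fun h => Or.inl h
  have rX : ∀ ω ∈ SgR, ∀ {t : Fin n}, t ∉ L → t ≠ s →
      (ω ∈ openConn t x ↔ ω ∈ openConnIn V₂ x t ∨ (ω ∈ SR ∧ ω ∈ {ω : BondConfig (Fin n) | ∃ u ∈ R₀, s(s, u) ∈ ω ∧ ω ∈ openConnIn V₂ u t})) := by
    intro ω hω t htL hts
    have ht2 : t ∈ V₂ := ⟨htL, hts⟩
    have hω₂ := rootPair_cut_hω' L (s := s) (x := x) (hRω ω hω)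
    constructor
    · intro h
      rcases openConn_avoid_or_through s (show ω ∈ openConn x t from SimpleGraph.Reachable.symm h) with h' | h'
      · rw [← rootPair_sides_union L hxs hsL, Set.union_comm] at h'
        exact Or.inl ((IncStarCutVertex.openConnIn_union_iff_of_mem_left (V₁ := V₂) (V₂ := V₁)
          (fun y hy2 hy1 => hV y hy1 hy2) hx2 hx1 hω₂ hx2 ht2).1 h')
      · have hsx : ω ∈ openConn s x := SimpleGraph.Reachable.trans h' h
        exact Or.inr ⟨(rS ω hω hxL hxs).1 hsx, (rS ω hω htL hts).1 h'⟩
    · rintro (h | ⟨hS, hT⟩)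
      · exact SimpleGraph.Reachable.symm (openConn_of_openConnIn h)
      · have h1 : ω ∈ openConn s x := (rS ω hω hxL hxs).2 hS
        have h2 : ω ∈ openConn s t := (rS ω hω htL hts).2 hT
        exact SimpleGraph.Reachable.trans (SimpleGraph.Reachable.symm h2) h1
  have restrR : ∀ {A : Set (BondConfig (Fin n))}, DeterminedBy A KR → (prodBernoulli wR).real A = (prodBernoulli w0).real A := by
    intro A hA; rw [hwR]; exact real_restrict_eq_of_determinedBy hA w0
  -- the ten events of `Ψ`
  have q1 : (prodBernoulli wR).real (openConn s x)ᶜ = (prodBernoulli w0).real (Set.univ \ SR) := by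
    rw [← restrR (hdiff (determinedBy_univ _) dSR)]
    exact rpf_congr hSgR1 fun ω hω => by
      rw [Set.mem_compl_iff, rS ω hω hxL hxs, Set.mem_sdiff]; exact ⟨fun h => ⟨Set.mem_univ _, h⟩, fun h => h.2⟩
  have q2 : (prodBernoulli wR).real ((openConn b x \ openConn s x) ∩ openConn s c) = (prodBernoulli w0).real ((Fb \ SR) ∩ BRc) := by
    rw [← restrR ((hdiff dFb dSR).inter dBRc)]
    exact rpf_congr hSgR1 fun ω hω => by
      rw [Set.mem_inter_iff, Set.mem_sdiff, rX ω hω hbL hbs, rS ω hω hxL hxs, rS ω hω hcL hcs, Set.mem_inter_iff, Set.mem_sdiff]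
      tauto
  have q3 : (prodBernoulli wR).real ((openConn c x \ openConn s x) ∩ openConn s b) = (prodBernoulli w0).real ((Fc \ SR) ∩ BRb) := by
    rw [← restrR ((hdiff dFc dSR).inter dBRb)]
    exact rpf_congr hSgR1 fun ω hω => by
      rw [Set.mem_inter_iff, Set.mem_sdiff, rX ω hω hcL hcs, rS ω hω hxL hxs, rS ω hω hbL hbs, Set.mem_inter_iff, Set.mem_sdiff]
      tauto
  have q4 : (prodBernoulli wR).real ((openConn b x ∩ openConn c x) \ openConn s x) = (prodBernoulli w0).real ((Fb ∩ Fc) \ SR) := by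
    rw [← restrR (hdiff (dFb.inter dFc) dSR)]
    exact rpf_congr hSgR1 fun ω hω => by
      rw [Set.mem_sdiff, Set.mem_inter_iff, rX ω hω hbL hbs, rX ω hω hcL hcs, rS ω hω hxL hxs, Set.mem_sdiff, Set.mem_inter_iff]
      tauto
  have q5 : (prodBernoulli wR).real (openConn b x \ openConn s x) = (prodBernoulli w0).real (Fb \ SR) := by
    rw [← restrR (hdiff dFb dSR)]
    exact rpf_congr hSgR1 fun ω hω => by
      rw [Set.mem_sdiff, rX ω hω hbL hbs, rS ω hω hxL hxs, Set.mem_sdiff]; tauto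
  have q6 : (prodBernoulli wR).real (openConn c x \ openConn s x) = (prodBernoulli w0).real (Fc \ SR) := by
    rw [← restrR (hdiff dFc dSR)]
    exact rpf_congr hSgR1 fun ω hω => by
      rw [Set.mem_sdiff, rX ω hω hcL hcs, rS ω hω hxL hxs, Set.mem_sdiff]; tauto
  have q7 : (prodBernoulli wR).real ((openConn s x)ᶜ ∩ (openConn c x)ᶜ ∩ openConn s c) = (prodBernoulli w0).real (BRc \ SR) := by
    rw [← restrR (hdiff dBRc dSR)]
    exact rpf_congr hSgR1 fun ω hω => by
      rw [Set.mem_inter_iff, Set.mem_inter_iff, Set.mem_compl_iff, Set.mem_compl_iff, rX ω hω hcL hcs, rS ω hω hxL hxs,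
        rS ω hω hcL hcs, Set.mem_sdiff]
      constructor
      · rintro ⟨⟨hS, -⟩, hC⟩; exact ⟨hC, hS⟩
      · rintro ⟨hC, hS⟩
        exact ⟨⟨hS, fun h => h.elim (fun hF => hS (fR1 ω hC hF)) fun h' => hS h'.1⟩, hC⟩
  have q8 : (prodBernoulli wR).real ((openConn s x)ᶜ ∩ (openConn b x)ᶜ ∩ openConn s b) = (prodBernoulli w0).real (BRb \ SR) := by
    rw [← restrR (hdiff dBRb dSR)]
    exact rpf_congr hSgR1 fun ω hω => by
      rw [Set.mem_inter_iff, Set.mem_inter_iff, Set.mem_compl_iff, Set.mem_compl_iff, rX ω hω hbL hbs, rS ω hω hxL hxs,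
        rS ω hω hbL hbs, Set.mem_sdiff]
      constructor
      · rintro ⟨⟨hS, -⟩, hB⟩; exact ⟨hB, hS⟩
      · rintro ⟨hB, hS⟩
        exact ⟨⟨hS, fun h => h.elim (fun hF => hS (fR1 ω hB hF)) fun h' => hS h'.1⟩, hB⟩
  have q9 : (prodBernoulli wR).real (openConn c x ∪ openConn s c) = (prodBernoulli w0).real (BRc ∪ Fc) := by
    rw [← restrR (hunion dBRc dFc)]
    exact rpf_congr hSgR1 fun ω hω => by
      rw [Set.mem_union, Set.mem_union, rX ω hω hcL hcs, rS ω hω hcL hcs]; tauto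
  have q10 : (prodBernoulli wR).real (openConn b x ∪ openConn s b) = (prodBernoulli w0).real (BRb ∪ Fb) := by
    rw [← restrR (hunion dBRb dFb)]
    exact rpf_congr hSgR1 fun ω hω => by
      rw [Set.mem_union, Set.mem_union, rX ω hω hbL hbs, rS ω hω hbL hbs]; tauto
  have zB : (prodBernoulli w0).real (BRb ∪ Fb) = (prodBernoulli w0).real BRb + (prodBernoulli w0).real (Fb \ SR) :=
    rootStar_union_split (prodBernoulli w0) R₀ V₂ s x b
  have zC : (prodBernoulli w0).real (BRc ∪ Fc) = (prodBernoulli w0).real BRc + (prodBernoulli w0).real (Fc \ SR) :=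
    rootStar_union_split (prodBernoulli w0) R₀ V₂ s x c
  have hΨ := psi_nonneg wR b c hxs hforestR
  rw [q1, q2, q3, q4, q5, q6, q7, q8, q9, q10, zB, zC] at hΨ
  -- ================= the near block: restricted weight `wL` =================
  obtain ⟨wL, hwL⟩ : ∃ f : Sym2 (Fin n) → unitInterval,
      f = fun z => @ite _ (z ∈ KL) (Classical.propDecidable (z ∈ KL)) (w0 z) 0 := ⟨_, rfl⟩
  have hwL0 : ∀ z, z ∉ KL → wL z = 0 := fun z hz => by simp only [hwL, if_neg hz]
  have hforestL : (SimpleGraph.fromEdgeSet {z : Sym2 (Fin n) | s ∉ z ∧ wL z ≠ 0}).IsAcyclic := by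
    refine hforest.anti fun p q hpq => ?_
    rw [SimpleGraph.fromEdgeSet_adj] at hpq ⊢
    obtain ⟨⟨hs', hw'⟩, hne⟩ := hpq
    refine ⟨⟨hs', w0_ne _ fun h0 => hw' ?_⟩, hne⟩
    by_cases hz : s(p, q) ∈ KL
    · simp only [hwL, if_pos hz, h0]
    · simp only [hwL, if_neg hz]
  set SgL : Set (BondConfig (Fin n)) := {ω | ∀ z, wL z = 0 → z ∉ ω}
  have hSgL1 : (prodBernoulli wL).real SgL = 1 := real_sureClosed wL
  have hLω : ∀ ω ∈ SgL, ∀ y z : Fin n, y ∈ L → z ∉ L → z ≠ s → z ≠ x → s(y, z) ∉ ω :=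
    fun ω hω y z hy hz hzs hzx => hω _ (hwL0 _ (cross_notL y z hy hz hzs hzx))
  have hLe : ∀ ω ∈ SgL, e ∉ ω := fun ω hω => hω _ (hwL0 _ e_notL)
  have hLSR : ∀ ω ∈ SgL, ∀ t : Fin n, ω ∉ {ω : BondConfig (Fin n) | ∃ u ∈ R₀, s(s, u) ∈ ω ∧ ω ∈ openConnIn V₂ u t} := by
    rintro ω hω t ⟨u, hu, hsu, -⟩
    exact hω _ (hwL0 _ (Rroot_notL u hu)) hsu
  have lS : ∀ ω ∈ SgL, ∀ {t : Fin n}, t ∈ V₁ →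
      (ω ∈ openConn s t ↔ ω ∈ {ω : BondConfig (Fin n) | ∃ u ∈ L, s(s, u) ∈ ω ∧ ω ∈ openConnIn V₁ u t}) := by
    intro ω hω t ht
    rw [rootPair_conn_left L hxs hsL hxL (hLω ω hω) (hLe ω hω) ht]
    constructor
    · rintro (h | ⟨hS, -⟩)
      · exact h
      · exact absurd hS (hLSR ω hω x)
    · exact fun h => Or.inl h
  have lX : ∀ ω ∈ SgL, ∀ {t : Fin n}, t ∈ V₁ →
      (ω ∈ openConn t x ↔ ω ∈ openConnIn V₁ x t ∨ (ω ∈ SL ∧ ω ∈ {ω : BondConfig (Fin n) | ∃ u ∈ L, s(s, u) ∈ ω ∧ ω ∈ openConnIn V₁ u t})) := by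
    intro ω hω t ht
    have hω₁ := rootPair_cut_hω L (s := s) (x := x) (hLω ω hω)
    constructor
    · intro h
      rcases openConn_avoid_or_through s (show ω ∈ openConn x t from SimpleGraph.Reachable.symm h) with h' | h'
      · rw [← rootPair_sides_union L hxs hsL] at h'
        exact Or.inl ((IncStarCutVertex.openConnIn_union_iff_of_mem_left hV hx1 hx2 hω₁ hx1 ht).1 h')
      · have hsx : ω ∈ openConn s x := SimpleGraph.Reachable.trans h' h
        exact Or.inr ⟨(lS ω hω hx1).1 hsx, (lS ω hω ht).1 h'⟩
    · rintro (h | ⟨hS, hT⟩)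
      · exact SimpleGraph.Reachable.symm (openConn_of_openConnIn h)
      · have h1 : ω ∈ openConn s x := (lS ω hω hx1).2 hS
        have h2 : ω ∈ openConn s t := (lS ω hω ht).2 hT
        exact SimpleGraph.Reachable.trans (SimpleGraph.Reachable.symm h2) h1
  have restrL : ∀ {A : Set (BondConfig (Fin n))}, DeterminedBy A KL → (prodBernoulli wL).real A = (prodBernoulli w0).real A := by
    intro A hA; rw [hwL]; exact real_restrict_eq_of_determinedBy hA w0
  have p1 : (prodBernoulli wL).real (openConn s x)ᶜ = (prodBernoulli w0).real (Set.univ \ SL) := by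
    rw [← restrL (hdiff (determinedBy_univ _) dSL)]
    exact rpf_congr hSgL1 fun ω hω => by
      rw [Set.mem_compl_iff, lS ω hω hx1, Set.mem_sdiff]; exact ⟨fun h => ⟨Set.mem_univ _, h⟩, fun h => h.2⟩
  have p2 : (prodBernoulli wL).real (openConn a x ∪ openConn s a) = (prodBernoulli w0).real (AL ∪ Fa) := by
    rw [← restrL (hunion dAL dFa)]
    exact rpf_congr hSgL1 fun ω hω => by
      rw [Set.mem_union, Set.mem_union, lX ω hω haL, lS ω hω haL]; tauto
  have p3 : (prodBernoulli wL).real (openConn a x \ openConn s x) = (prodBernoulli w0).real (Fa \ SL) := by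
    rw [← restrL (hdiff dFa dSL)]
    exact rpf_congr hSgL1 fun ω hω => by
      rw [Set.mem_sdiff, lX ω hω haL, lS ω hω hx1, Set.mem_sdiff]; tauto
  have p4 : (prodBernoulli wL).real ((openConn s x)ᶜ ∩ (openConn a x)ᶜ ∩ openConn s a) = (prodBernoulli w0).real (AL \ SL) := by
    rw [← restrL (hdiff dAL dSL)]
    exact rpf_congr hSgL1 fun ω hω => by
      rw [Set.mem_inter_iff, Set.mem_inter_iff, Set.mem_compl_iff, Set.mem_compl_iff, lX ω hω haL, lS ω hω hx1, lS ω hω haL,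
        Set.mem_sdiff]
      constructor
      · rintro ⟨⟨hS, -⟩, hA⟩; exact ⟨hA, hS⟩
      · rintro ⟨hA, hS⟩
        exact ⟨⟨hS, fun h => h.elim (fun hF => hS (fL1 ω hA hF)) fun h' => hS h'.1⟩, hA⟩
  have zA : (prodBernoulli w0).real (AL ∪ Fa) = (prodBernoulli w0).real AL + (prodBernoulli w0).real (Fa \ SL) :=
    rootStar_union_split (prodBernoulli w0) L V₁ s x a
  have hBr := branchLemma wL a hxs hforestL
  rw [p1, p2, p3, p4, zA] at hBr
  -- ================= conclude =================
  simp only [hSR_def, hSL_def, hAL_def, hFa_def, hFb_def, hFc_def, hBRb_def, hBRc_def, hR₀_def, hV₁_def, hV₂_def, hw0, he_def] at hΨ hBr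
  exact rootPair_threePoint w L hxs hsL hxL haL hbL hbs hcL hcs hcross p₀ p p₁ h01 h12 hΨ hBr

/-- **THEOREM B′-forest (root-pair chord at a separating vertex, or at a target).**  The case `(p₀, p, p₁) = (0, w e, 1)` of
`rootPair_threePoint_of_apexForest`. [this work] -/
theorem rootPair_chord_of_apexForest (w : Sym2 (Fin n) → unitInterval) (L : Set (Fin n)) {s x a b c : Fin n}
    (hxs : x ≠ s) (hsL : s ∉ L) (hxL : x ∉ L) (haL : a ∈ (insert x L : Set (Fin n)))
    (hbL : b ∉ L) (hbs : b ≠ s) (hcL : c ∉ L) (hcs : c ≠ s)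
    (hcross : ∀ y z : Fin n, y ∈ L → z ∉ L → z ≠ s → z ≠ x → w s(y, z) = 0)
    (hforest : (SimpleGraph.fromEdgeSet {z : Sym2 (Fin n) | s ∉ z ∧ w z ≠ 0}).IsAcyclic) :
    (1 - (w s(s, x) : ℝ)) * sahiE3 (prodBernoulli (Function.update w s(s, x) 0)) (openConn s a) (openConn s b) (openConn s c)
      + (w s(s, x) : ℝ) * sahiE3 (prodBernoulli (Function.update w s(s, x) 1)) (openConn s a) (openConn s b) (openConn s c)
    ≤ sahiE3 (prodBernoulli w) (openConn s a) (openConn s b) (openConn s c) := by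
  have h := rootPair_threePoint_of_apexForest w L hxs hsL hxL haL hbL hbs hcL hcs hcross hforest 0 (w s(s, x)) 1
    bot_le le_top
  rw [Function.update_eq_self] at h
  simpa using h

end IncStar

end Summit.CriticalPhenomena.PercolationContinuityZ3.Theorems
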